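import Literature.AlgebraicGeometry.Morphisms.FormalModuleGraded
import Literature.AlgebraicGeometry.Morphisms.FormalModuleNakayama
import Literature.AlgebraicGeometry.Morphisms.FormalModuleCompletion
import Literature.AlgebraicGeometry.Morphisms.CechModuleExactH0
import Literature.AlgebraicGeometry.Morphisms.CechModuleShortExact
import Literature.AlgebraicGeometry.Morphisms.CohAffineExactness
import Literature.AlgebraicGeometry.Morphisms.CohOfVectorBundle
import Literature.AlgebraicGeometry.Modules.SerreTheoremA
import Literature.AlgebraicGeometry.Modules.SerreTwistSum
import Literature.AlgebraicGeometry.Modules.SerreVanishingTwist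
import Literature.AlgebraicGeometry.Modules.SheafHomExact
import Literature.AlgebraicGeometry.Modules.SheafHomCoh
import Literature.AlgebraicGeometry.Modules.IsoOfFrames
import Literature.AlgebraicGeometry.Resolution.ChowLemmaRing
import HarnessLib

/-!
# Serre's theorem A for coherent formal modules on a projective scheme (GW II Lemma 24.103, Step 1)

Görtz–Wedhorn, *Algebraic Geometry II* (2023), proof of Lemma 24.103 (p. 570), first step, for a closed
subscheme `Z ⊆ 𝐏ʳ_A` over a Noetherian ring `A` and a coherent `𝒪_{Z/Z₀}`-module `ℱ = (ℱ_n)_n`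
(here: a formal tower `F` along a global function `a`, `Morphisms/FormalModuleTower`): "By
Proposition 24.102 there exists `m` such that `H¹(X, 𝓘ⁿℱ/𝓘ⁿ⁺¹ℱ(m)) = 0` for all `n ≥ 0` … the maps
`Γ(ℱ_{n+1}(m)) → Γ(ℱ_n(m))` are surjective … generators of `ℱ₀(m)` lift compatibly … we obtain a
surjection `𝒪_X(-m)^N_{/Z} ↠ ℱ`". We prove:

* `exists_comp_eq_of_epi_of_subsingleton_cechMH1` — **lifting a morphism `L → G` from a finite
  locally free `L` along an epimorphism `G' ↠ G`** when `Ȟ¹(𝒰; 𝓗om(L, ker)) = 0` on an affine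
  cover (long exact Čech sequence, `Morphisms/CechModuleExactH0`);
* `exists_forall_subsingleton_cechMH1_sheafHom_Lpow_gr` — **uniform Serre vanishing
  `Ȟ¹(𝒰; 𝓗om(L_N(-m), grₙ F)) = 0` for all `n`, `N` and all `m ≥ d₀`** (GW II Prop. 24.102 in the
  principal-ideal case: the graded pieces `grₙ F = ker(F_{n+1} → F_n)` take finitely many values,
  `Morphisms/FormalModuleGraded`, and Serre A + B₁ for each, `Modules/SerreTheoremA`,
  `Modules/SerreVanishingTwist`, `Modules/SerreTwistSum`);
* `exists_levelwise_epi_cmplTower_Lpow` — **there are `m ≥ d`, `N` and a morphism of towers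
  `q : (L_N(-m)/aⁿ⁺¹)_n → F` which is an epimorphism at every level** (Serre A at level `0`,
  compatible lifts by the first two items, Nakayama for formal towers
  `Morphisms/FormalModuleNakayama`).

Everything is proved; no named facts.

## References

* U. Görtz, T. Wedhorn, *Algebraic Geometry II: Cohomology of Schemes*, Springer Spektrum (2023),
  Prop. 24.102, Lemma 24.103 (pp. 569–570). [GortzWedhorn2023]
* A. Grothendieck, EGA III₁ (1961), Cor. 5.2.4 and its proof. [EGAIII1]
* R. Hartshorne, *Algebraic Geometry* (1977): II Thm. 5.17, III Thm. 5.2. [Hartshorne1977]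
-/

noncomputable section

-- `TopCat.Presheaf`/`TopCat.Sheaf` are not reducible (as in Mathlib's `AlgebraicGeometry/Modules`).
set_option backward.isDefEq.respectTransparency false

open CategoryTheory AlgebraicGeometry Limits TopologicalSpace Opposite
open Literature.AlgebraicGeometry.Modules Literature.AlgebraicGeometry.Modules.SerreTwist
open Literature.AlgebraicGeometry.Morphisms.ProjCech Literature.AlgebraicGeometry.Motives

universe u

namespace Literature.AlgebraicGeometry.Morphisms

/-! ### Lifting morphisms from a vector bundle along an epimorphism with `Ȟ¹(𝓗om(L, ker)) = 0` -/

section Lift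

variable {A : Type u} [CommRing A] {X : Scheme.{u}} (f : X ⟶ Spec (.of A)) {κ : Type*}
  (U : κ → X.Opens)

/-- **Lifting.** Let `g : G' ↠ G` be an epimorphism of `𝒪_X`-modules, `L` finite locally free with
`𝓗om(L, ker g)` affine-localizing and `Ȟ¹(𝒰; 𝓗om(L, ker g)) = 0` for an affine open cover `𝒰`. Then
every `v : L → G` lifts to `w : L → G'` with `w ≫ g = v` (the long exact Čech sequence of
`0 → 𝓗om(L, ker g) → 𝓗om(L, G') → 𝓗om(L, G) → 0` in degrees `0, 1`).
[cite: GortzWedhorn2023, Lemma 24.103, proof, Step 1 (p. 570)] -/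
theorem exists_comp_eq_of_epi_of_subsingleton_cechMH1 (hUaff : ∀ i, IsAffineOpen (U i))
    (hUcov : ⨆ i, U i = ⊤) {L G' G : X.Modules} (hL : IsFiniteLocallyFree L) (g : G' ⟶ G) [Epi g]
    (hQ : IsAffineLocalizing (sheafHom L (kernel g)))
    (hH1 : Subsingleton (CechMH1 f (sheafHom L (kernel g)) U)) (v : L ⟶ G) :
    ∃ w : L ⟶ G', w ≫ g = v := by
  haveI := preservesFiniteColimits_sheafHomFunctor L hL
  let S : ShortComplex X.Modules := ShortComplex.mk (kernel.ι g) g (kernel.condition g)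
  have hS : S.ShortExact := shortExact_kernel_of_epi g
  let S' := S.map (sheafHomFunctor L)
  have hS' : S'.ShortExact := hS.map_of_exact (sheafHomFunctor L)
  have hdata : CechExactData f U S'.f S'.g := CechExactData.of_shortExact f U hS' hQ hUaff
  -- `v` as a `0`-cocycle of `𝓗om(L, G)`
  let vt : MSections f S'.X₃ ⊤ := ((SheafOfModules.overFunctor _ ⊤).map v : L.over ⊤ ⟶ G.over ⊤)
  let b'' : cechMH0 f S'.X₃ U := cechMH0EquivSections f U S'.X₃ hUcov vt
  have hδ : hdata.cechDelta b'' = 0 := @Subsingleton.elim _ hH1 _ _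
  obtain ⟨b, hb⟩ := hdata.exists_cechMapH0_eq_of_cechDelta_eq_zero b'' hδ
  -- the lift over `⊤`
  let ψ : L.over ⊤ ⟶ G'.over ⊤ := (cechMH0EquivSections f U S'.X₂ hUcov).symm b
  have hnat : (cechMH0EquivSections f U S'.X₃ hUcov).symm (cechMapH0 f S'.g U b) =
      MSections.app f S'.g ⊤ ψ := by
    apply (cechMH0EquivSections f U S'.X₃ hUcov).injective
    rw [LinearEquiv.apply_symm_apply]
    apply Subtype.ext
    funext i
    rw [cechMapH0_coe, cechMapC0_apply]
    conv_lhs => rw [← (cechMH0EquivSections f U S'.X₂ hUcov).apply_symm_apply b]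
    change MSections.app f S'.g (U i) (MSections.res f S'.X₂ le_top _) = MSections.res f S'.X₃ le_top _
    rw [MSections.res_app]
  rw [hb, LinearEquiv.symm_apply_apply] at hnat
  have hψ : ψ ≫ (SheafOfModules.overFunctor _ ⊤).map g = (SheafOfModules.overFunctor _ ⊤).map v :=
    hnat.symm
  refine ⟨homOfTop ψ, Scheme.Modules.hom_ext _ _ fun W => ?_⟩
  ext s
  rw [Scheme.Modules.Hom.comp_app, CategoryTheory.comp_apply, homOfTop_app,
    ← appLE_over_map v (homOfLE (le_top : W ≤ ⊤)), ← hψ, appLE_comp, appLE_over_map]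

end Lift

/-! ### Uniform Serre vanishing for the graded pieces and the levelwise epimorphism -/

section Projective

set_option backward.isDefEq.respectTransparency true in
/-- A closed subscheme of `𝐏ʳ_A`, `A` Noetherian, is locally Noetherian. [folklore] -/
theorem isLocallyNoetherian_of_isClosedImmersion_PP {A : Type u} [CommRing A] [IsNoetherianRing A]
    {r : ℕ} {Z : Scheme.{u}} (ι : Z ⟶ PP A r) [IsClosedImmersion ι] : IsLocallyNoetherian Z := by
  haveI : IsProper (toSpec A r) := Motives.ProjBaseChangeRing.isProper_projToSpec (Fin (r + 1)) A
  haveI : IsProper (strZ ι) := inferInstance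
  exact LocallyOfFiniteType.isLocallyNoetherian (strZ ι)

set_option backward.isDefEq.respectTransparency true in
/-- A closed subscheme of `𝐏ʳ_A` is quasi-compact. [folklore] -/
theorem compactSpace_of_isClosedImmersion_PP {A : Type u} [CommRing A] {r : ℕ} {Z : Scheme.{u}}
    (ι : Z ⟶ PP A r) [IsClosedImmersion ι] : CompactSpace Z := by
  haveI : IsProper (toSpec A r) := Motives.ProjBaseChangeRing.isProper_projToSpec (Fin (r + 1)) A
  haveI : IsProper (strZ ι) := inferInstance
  exact QuasiCompact.compactSpace_of_compactSpace (strZ ι)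

variable {A : Type u} [CommRing A] [IsNoetherianRing A] {r : ℕ} {Z : Scheme.{u}} (ι : Z ⟶ PP A r)
  [IsClosedImmersion ι] (a : Γ(Z, ⊤)) {F : ℕᵒᵖ ⥤ Z.Modules} (hF : IsFormalTower a F)
  (hFc : ∀ n, Coh (F.obj ⟨n⟩))

include hFc in
/-- **Uniform Serre vanishing for the graded pieces** (GW II Prop. 24.102 for the principal ideal `(a)`):
there is `d₀` with `Ȟ¹(𝒰; 𝓗om(L_N(-m), grₙ F)) = 0` on the standard affine cover `𝒰` of `Z` for all
`m ≥ d₀` and all `n`, `N` — the `grₙ F` run through finitely many isomorphism classes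
(`IsFormalTower.exists_uniform_gr`) and each satisfies Serre A and B₁.
[cite: GortzWedhorn2023, Prop. 24.102 (p. 569)] -/
theorem exists_forall_subsingleton_cechMH1_sheafHom_Lpow_gr :
    ∃ d₀ : ℕ, ∀ m, d₀ ≤ m → ∀ n N : ℕ,
      Subsingleton (CechMH1 (strZ ι) (sheafHom (Lpow ι m N) (hF.gr n)) (cover ι)) := by
  haveI := isLocallyNoetherian_of_isClosedImmersion_PP ι
  haveI := compactSpace_of_isClosedImmersion_PP ι
  obtain ⟨d₀, hd₀⟩ := hF.exists_uniform_gr hFc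
    (P := fun M m => ∀ N : ℕ, Subsingleton (CechMH1 (strZ ι) (sheafHom (Lpow ι m N) M) (cover ι)))
    (fun e m h N => subsingleton_cechMH1_of_iso (strZ ι) (cover ι)
      ((sheafHomFunctor (Lpow ι m N)).mapIso e.symm) (h N))
    fun n => by
      have hG : Coh (hF.gr n) := hF.coh_gr hFc n
      obtain ⟨mA, hA⟩ := exists_generators ι (hF.gr n) hG
      obtain ⟨N₀, g₀, hgen₀⟩ := hA mA le_rfl
      obtain ⟨d₁, hd₁⟩ := exists_forall_subsingleton_cechMH1_twistMod ι (hF.gr n) mA g₀ hG.loc hgen₀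
      exact ⟨d₁, fun m hm N => subsingleton_cechMH1_sheafHom_Lpow ι (hF.gr n) m (strZ ι) (cover ι)
        (hd₁ m hm) N⟩
  exact ⟨d₀, fun m hm n N => hd₀ n m hm N⟩

omit [IsNoetherianRing A] in
include hFc in
/-- **Serre A at level `0` in large degree**: for every `d` there are `m ≥ d`, `N` and global sections
`g_j` of `F₀(m)` such that `L_N(-m) → F₀` is an epimorphism. [cite: Hartshorne1977, II Thm. 5.17 (p. 121)] -/
theorem exists_epi_piPow (d : ℕ) : ∃ m : ℕ, d ≤ m ∧ ∃ (N : ℕ) (g : ℕ → Γ(twistMod ι (F.obj ⟨0⟩) m, ⊤)),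
    Epi (piPow ι (F.obj ⟨0⟩) m g N) := by
  obtain ⟨mA, hA⟩ := exists_generators ι (F.obj ⟨0⟩) (hFc 0)
  obtain ⟨N, g, hgen⟩ := hA (max d mA) (le_max_right _ _)
  let g' : ℕ → Γ(twistMod ι (F.obj ⟨0⟩) (max d mA), ⊤) := fun j => if hj : j < N + 1 then g ⟨j, hj⟩ else 0
  have hg' : ∀ j : Fin (N + 1), g' j = g j := fun j => by simp only [g', dif_pos j.2]
  refine ⟨max d mA, le_max_left _ _, N, g', epi_piPow ι (F.obj ⟨0⟩) (max d mA) g' (hFc 0).loc N fun i t => ?_⟩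
  have h := generates_singleton ι (F.obj ⟨0⟩) (max d mA) N g hgen i t
  simp only [← hg'] at h
  exact h

include hF hFc in
/-- **Compatible lifts**: if `Ȟ¹(𝒰; 𝓗om(L, grₙ F)) = 0` for all `n` (`L` finite locally free), every
`v₀ : L → F₀` extends to a family `vₙ : L → Fₙ` with `v_{n+1} ≫ (F_{n+1} → F_n) = v_n`.
[cite: GortzWedhorn2023, Lemma 24.103, proof, Step 1 (p. 570)] -/
theorem exists_compatible_lifts {L : Z.Modules} (hL : IsFiniteLocallyFree L)
    (hH1 : ∀ n, Subsingleton (CechMH1 (strZ ι) (sheafHom L (hF.gr n)) (cover ι)))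
    (v₀ : L ⟶ F.obj ⟨0⟩) :
    ∃ v : ∀ n, L ⟶ F.obj ⟨n⟩, v 0 = v₀ ∧ ∀ n, v (n + 1) ≫ towerπ F n = v n := by
  haveI := isLocallyNoetherian_of_isClosedImmersion_PP ι
  have hLc : Coh L := coh_of_isVectorBundle hL.isVectorBundle
  have hstep : ∀ (n : ℕ) (vn : L ⟶ F.obj ⟨n⟩), ∃ w : L ⟶ F.obj ⟨n + 1⟩, w ≫ towerπ F n = vn := by
    intro n vn
    haveI := hF.epi n
    exact exists_comp_eq_of_epi_of_subsingleton_cechMH1 (strZ ι) (cover ι) (isAffineOpen_cover ι)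
      (iSup_cover_eq_top ι) hL (towerπ F n)
      (isAffineLocalizing_sheafHom hLc.loc hLc.ft (hF.coh_gr hFc n).loc) (hH1 n) vn
  choose w hw using hstep
  let v : ∀ n, L ⟶ F.obj ⟨n⟩ := fun n => Nat.rec v₀ (fun k vk => w k vk) n
  exact ⟨v, rfl, fun n => hw n (v n)⟩

include hF in
/-- A compatible family `vₙ : L → Fₙ` induces a morphism of towers `(L/aⁿ⁺¹L)_n → F` which is `vₙ` on
`L → L/aⁿ⁺¹L`. [cite: GortzWedhorn2023, (24.18.1) and Lemma 24.103, proof (p. 570)] -/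
theorem exists_towerHom_of_compatible {L : Z.Modules} (v : ∀ n, L ⟶ F.obj ⟨n⟩)
    (hv : ∀ n, v (n + 1) ≫ towerπ F n = v n) :
    ∃ q : cmplTower a L ⟶ F, ∀ n, cmplπ a L n ≫ q.app ⟨n⟩ = v n := by
  have hkill : ∀ n, globalScalar L (a ^ (n + 1)) ≫ v n = 0 := fun n => by
    rw [globalScalar_comp, hF.killed n, Limits.comp_zero]
  refine ⟨NatTrans.ofOpSequence (fun n => cokernel.desc _ (v n) (hkill n)) fun n => ?_, fun n => ?_⟩
  · change towerπ (cmplTower a L) n ≫ cokernel.desc _ (v n) (hkill n) =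
      cokernel.desc _ (v (n + 1)) (hkill (n + 1)) ≫ towerπ F n
    rw [towerπ_cmplTower, ← cancel_epi (cmplπ a L (n + 1)), ← Category.assoc, cmplπ_cmplStep,
      cokernel.π_desc, ← Category.assoc, cokernel.π_desc, hv]
  · exact cokernel.π_desc _ _ _

include hF hFc in
/-- **Step 1 of GW II Lemma 24.103 (Serre A for coherent formal modules on a projective scheme):**
for a coherent formal tower `F` along `a` on a closed subscheme `Z ⊆ 𝐏ʳ_A` (`A` Noetherian) and any
`d`, there are `m ≥ d`, `N` and a morphism of towers `q : (L_N(-m)/aⁿ⁺¹)_n → F`,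
`L_N(-m) = 𝒪_Z(-m)^{⊕(N+1)}`, which is an epimorphism at every level.
[cite: GortzWedhorn2023, Lemma 24.103, proof, Step 1 (p. 570)] -/
theorem exists_levelwise_epi_cmplTower_Lpow (d : ℕ) :
    ∃ m N : ℕ, d ≤ m ∧ ∃ q : cmplTower a (Lpow ι m N) ⟶ F, ∀ n, Epi (q.app ⟨n⟩) := by
  obtain ⟨d₀, hd₀⟩ := exists_forall_subsingleton_cechMH1_sheafHom_Lpow_gr ι a hF hFc
  obtain ⟨m, hm, N, g, hepi⟩ := exists_epi_piPow ι hFc (max d d₀)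
  obtain ⟨v, hv0, hv⟩ := exists_compatible_lifts ι a hF hFc (isFiniteLocallyFree_Lpow ι m N)
    (fun n => hd₀ m ((le_max_right _ _).trans hm) n N) (piPow ι (F.obj ⟨0⟩) m g N)
  obtain ⟨q, hq⟩ := exists_towerHom_of_compatible a hF v hv
  refine ⟨m, N, (le_max_left _ _).trans hm, q, fun n => ?_⟩
  haveI : Epi (q.app ⟨0⟩) := by
    haveI : Epi (cmplπ a (Lpow ι m N) 0 ≫ q.app ⟨0⟩) := by rw [hq 0, hv0]; exact hepi
    exact epi_of_epi (cmplπ a (Lpow ι m N) 0) _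
  exact IsFormalTower.epi_app_of_epi_app_zero (fun k => (isFormalTower_cmplTower a (Lpow ι m N)).epi k)
    hF q n

end Projective

end Literature.AlgebraicGeometry.Morphisms

end
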